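import Summits.HodgeConjecture.HodgeConjecture.Theorems.NikulinTwinTransportSquareHodgeOfSqrtTwoRationalCore
import Summits.HodgeConjecture.HodgeConjecture.Theorems.NikulinTwinTransportRealMultiplicationSqrtTwoAlgebraic

/-!
# Route NikulinTwinTransport · `SquareHodgeOfSqrtTwo` (stmt-HodgeConjecture-13680) —
# `End_Hdg(H²(S,ℚ)) = (NS ⊗ NS) ⊕ ℚ·id ⊕ ℚ·e` on the `√2`-sector, and its algebraicity

On the tree's carriers, for a projective K3 surface `S` (`IsK3Surface S`) with the hypotheses of the
route item `SquareHodgeOfSqrtTwo` on `e` (rational, kills `NS := algebraicClasses S 1`, `e² = 2` on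
`NS^⊥`, and — verbatim the item's last hypothesis — every rational type-preserving `f` killing `NS`
with image `⊥ NS` is `a + b·e` on `NS^⊥`, `a, b ∈ ℚ`):

* `endHodge_normalForm_H2` — granted a marking `η` with its period `x₀` and the K3 description of
  the Hodge types of `H²` (the shapes of the named facts `Huybrechts_K3_marking_exists`,
  `Huybrechts_K3_hodgeTypes_H2`, taken as data), `NS ⊆ H^{1,1}` and Lefschetz `(1,1)` for `S`
  (pointwise), EVERY rational type-preserving `ℂ`-linear `G : H²(S(ℂ); ℂ) → H²(S(ℂ); ℂ)` is
  `G x = Σᵢ (ηx.aᵢ) η⁻¹bᵢ + α x + β e x` with rational `η⁻¹aᵢ, η⁻¹bᵢ ∈ NS` and `α, β ∈ ℚ`, i.e.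
  `End_Hdg(H²(S,ℚ)) = (NS ⊗ NS) ⊕ ℚ·id ⊕ ℚ·e`. Proof: read through `η` and apply the rational core
  `ratEnd_normalForm` (sibling file `…RationalCore`).
* `induced_of_normalForm` — such a `G` is induced by an algebraic class of codimension `2` on
  `S × S` as soon as (D) divisor correspondences `x ↦ (x.a) b` (`a, b ∈ NS`) are, (Δ) the identity
  is (the diagonal), and `e` is (the route's deliverable `RealMultiplicationSqrtTwoAlgebraic`):
  `(Σγᵢ)_* = Σ(γᵢ)_*` (`induced_sum`, `induced_add`, `induced_smul`).

This is the `End_Hdg`-half of the Künneth bookkeeping `SquareGlue` (stmt-HodgeConjecture-13682) through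
which the item closes; the Künneth half is the frame hypothesis of the sibling file
`NikulinTwinTransportSquareHodgeOfSqrtTwo`. Sources: Varesco, Math. Z. 305 (2023) p. 8; Huybrechts,
*Lectures on K3 Surfaces* Ch. 3; Fulton §16.1. Prover seat prover-pitem-stmt-HodgeConjecture-13680-0.
-/

noncomputable section

namespace Summit.HodgeConjecture.HodgeConjecture.Theorems.NikulinTwinTransport

open scoped Manifold
open Module CategoryTheory MonoidalCategory
open Literature.AlgebraicGeometry.Motives Literature.AlgebraicGeometry.HodgeTheory
open Literature.AlgebraicGeometry.Surfaces Literature.Geometry.Kaehler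
open Literature.AlgebraicTopology.SingularHomology

/-! ### On the carriers: Hodge endomorphisms of `H²(S(ℂ); ℂ)` on the `√2`-sector -/

section Carrier

variable {S : SchemeOver ℂ}

/-- **Normal form of the Hodge endomorphisms of `H²` of a projective K3 surface on the
`√2`-sector.** Let `S` be a projective K3 surface with a marking `η` (integral classes `↔ Λ`,
`a ∪ b = (ηa.ηb) p₀`, `p₀ ≠ 0`) and period `x₀` (`H^{2,0} = ℂ η⁻¹x₀`, `H^{0,2} = ℂ η⁻¹x̄₀`,
`H^{1,1} = ⟨η⁻¹x₀, η⁻¹x̄₀⟩^⊥`); assume the divisor classes `NS := algebraicClasses S 1` are of type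
`(1,1)`, Lefschetz `(1,1)` for `S` (rational `(1,1)`-classes are in `NS`), and let `e` be rational,
`e|_{NS} = 0`, `e² = 2` on `NS^⊥`, with `End_Hdg(NS^⊥) ⊆ ℚ + ℚe` (the last hypothesis of the route
item `SquareHodgeOfSqrtTwo`, verbatim). Then every rational, type-preserving `ℂ`-linear
endomorphism `G` of `H²(S(ℂ); ℂ)` is
`G x = Σᵢ (ηx.aᵢ) η⁻¹bᵢ + α x + β e x` with `η⁻¹aᵢ, η⁻¹bᵢ ∈ NS` rational and `α, β ∈ ℚ` — i.e.
`End_Hdg(H²(S,ℚ)) = (NS ⊗ NS) ⊕ ℚ·id ⊕ ℚ·e`. Proof: read everything through `η` (`ratEnd_normalForm`).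
[cite: Huybrechts2016K3, Ch. 3 Lemma 3.3.1 and Thm. 3.3.7] [cite: Varesco2023, §2 (p. 8)] -/
theorem endHodge_normalForm_H2 (hS : IsK3Surface S)
    (η : complexBetti S (2 * 1) ≃ₗ[ℂ] (K3Index → ℂ)) (p₀ : complexBetti S (2 * 2)) (hp₀ : p₀ ≠ 0)
    (hηint : ∀ c : complexBetti S (2 * 1), IsIntegralClass c ↔ ∃ v : K3Index → ℤ, η c = fun i => (v i : ℂ))
    (hηcup : ∀ a b : complexBetti S (2 * 1),
      cupProduct (rfl : 2 * 1 + 2 * 1 = 2 * 2) a b = k3Form (η a) (η b) • p₀)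
    (x₀ : K3Index → ℂ)
    (h1 : ∀ c : complexBetti S (2 * 1), IsOfHodgeType 2 S (2 * 1) 2 0 c ↔ ∃ t : ℂ, c = t • η.symm x₀)
    (h2 : ∀ c : complexBetti S (2 * 1),
      IsOfHodgeType 2 S (2 * 1) 0 2 c ↔ ∃ t : ℂ, c = t • η.symm (star x₀))
    (h3 : ∀ c : complexBetti S (2 * 1), IsOfHodgeType 2 S (2 * 1) 1 1 c ↔
      cupProduct (rfl : 2 * 1 + 2 * 1 = 2 * 2) c (η.symm x₀) = 0 ∧
        cupProduct (rfl : 2 * 1 + 2 * 1 = 2 * 2) c (η.symm (star x₀)) = 0)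
    (hN11 : ∀ d ∈ algebraicClasses S 1, IsOfHodgeType 2 S (2 * 1) 1 1 d)
    (hL11 : ∀ c : complexBetti S (2 * 1), IsRationalClass c → IsOfHodgeType 2 S (2 * 1) 1 1 c →
      c ∈ algebraicClasses S 1)
    (e : complexBetti S (2 * 1) →ₗ[ℂ] complexBetti S (2 * 1))
    (he_rat : ∀ x, IsRationalClass x → IsRationalClass (e x))
    (he_N : ∀ d ∈ algebraicClasses S 1, e d = 0)
    (he_T : ∀ x : complexBetti S (2 * 1),
      (∀ d ∈ algebraicClasses S 1, cupProduct (rfl : 2 * 1 + 2 * 1 = 2 * 2) x d = 0) →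
        e (e x) = (2 : ℂ) • x)
    (hEnd : ∀ (f : complexBetti S (2 * 1) →ₗ[ℂ] complexBetti S (2 * 1)),
      (∀ x, IsRationalClass x → IsRationalClass (f x)) →
      (∀ (i j : ℕ) x, IsOfHodgeType 2 S (2 * 1) i j x → IsOfHodgeType 2 S (2 * 1) i j (f x)) →
      (∀ d ∈ algebraicClasses S 1, f d = 0) →
      (∀ x : complexBetti S (2 * 1), ∀ d ∈ algebraicClasses S 1,
        cupProduct (rfl : 2 * 1 + 2 * 1 = 2 * 2) (f x) d = 0) →
      ∃ a b : ℚ, ∀ x : complexBetti S (2 * 1),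
        (∀ d ∈ algebraicClasses S 1, cupProduct (rfl : 2 * 1 + 2 * 1 = 2 * 2) x d = 0) →
          f x = (a : ℂ) • x + (b : ℂ) • e x)
    (G : complexBetti S (2 * 1) →ₗ[ℂ] complexBetti S (2 * 1))
    (hG_rat : ∀ x, IsRationalClass x → IsRationalClass (G x))
    (hG_type : ∀ (i j : ℕ) x, IsOfHodgeType 2 S (2 * 1) i j x → IsOfHodgeType 2 S (2 * 1) i j (G x)) :
    ∃ (m : ℕ) (a b : Fin m → K3Index → ℚ) (α β : ℚ),
      (∀ i, η.symm (fun j => (a i j : ℂ)) ∈ algebraicClasses S 1) ∧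
      (∀ i, η.symm (fun j => (b i j : ℂ)) ∈ algebraicClasses S 1) ∧
      ∀ x, G x = ∑ i, k3Form (η x) (fun j => (a i j : ℂ)) • η.symm (fun j => (b i j : ℂ)) +
        (α : ℂ) • x + (β : ℂ) • e x := by
  classical
  set N := algebraicClasses S 1 with hNdef
  have hsmul : ∀ {c c' : ℂ}, c • p₀ = c' • p₀ → c = c' := fun h => smul_left_injective ℂ hp₀ h
  have hsmul0 : ∀ {c : ℂ}, c • p₀ = 0 → c = 0 := fun h => by
    rw [← zero_smul ℂ p₀] at h
    exact hsmul h
  -- `G` and `e` read through the marking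
  obtain ⟨g, hg⟩ := exists_ratEnd_of_forall_intCast (η.toLinearMap ∘ₗ G ∘ₗ η.symm.toLinearMap)
    (markingConj_intCast hS η hηint η hηint G hG_rat)
  have hg' : ∀ u : K3Index → ℚ, η (G (η.symm fun j => (u j : ℂ))) = fun j => (g u j : ℂ) := fun u => by
    simpa only [LinearMap.coe_comp, LinearEquiv.coe_coe, Function.comp_apply] using hg u
  obtain ⟨ε, hε⟩ := exists_ratEnd_of_forall_intCast (η.toLinearMap ∘ₗ e ∘ₗ η.symm.toLinearMap)
    (markingConj_intCast hS η hηint η hηint e he_rat)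
  have hε' : ∀ u : K3Index → ℚ, η (e (η.symm fun j => (u j : ℂ))) = fun j => (ε u j : ℂ) := fun u => by
    simpa only [LinearMap.coe_comp, LinearEquiv.coe_coe, Function.comp_apply] using hε u
  have hεx : ∀ u : K3Index → ℚ, e (η.symm fun j => (u j : ℂ)) = η.symm fun j => (ε u j : ℂ) := fun u => by
    rw [← hε' u, LinearEquiv.symm_apply_apply]
  -- the rational points of `N`
  let NQ : Submodule ℚ (K3Index → ℚ) :=
    { carrier := {u | η.symm (fun j => (u j : ℂ)) ∈ N}
      add_mem' := fun {u v} hu hv => by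
        simp only [Set.mem_setOf_eq, ratCastΛ_add, map_add]
        exact N.add_mem hu hv
      zero_mem' := by
        simp only [Set.mem_setOf_eq, ratCastΛ_zero, map_zero]
        exact N.zero_mem
      smul_mem' := fun q u hu => by
        simp only [Set.mem_setOf_eq, ratCastΛ_smul, map_smul]
        exact N.smul_mem _ hu }
  have memNQ : ∀ u, u ∈ NQ ↔ η.symm (fun j => (u j : ℂ)) ∈ N := fun u => Iff.rfl
  -- `N` is spanned by its rational classes; `N_ℚ^⊥` is orthogonal to `N`
  have hspan := span_isRationalClass_eq_top_of_isSmoothProjective_holds.supportedClasses_eq_span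
    hS.1 (2 * 1) 1
  have horth : ∀ u ∈ k3FormRat.orthogonal NQ, ∀ d ∈ N, k3Form (fun j => (u j : ℂ)) (η d) = 0 := by
    intro u hu d hd
    rw [LinearMap.BilinForm.mem_orthogonal_iff] at hu
    have hd' : d ∈ Submodule.span ℂ {c : complexBetti S (2 * 1) |
        IsRationalClass c ∧ c ∈ supportedClasses S (2 * 1) 1} := by
      rw [← hspan]; exact hd
    clear hd
    induction hd' using Submodule.span_induction with
    | mem d hd =>
      obtain ⟨w, hw⟩ := (isRationalClass_iff_of_marking hS η hηint d).1 hd.1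
      have hwN : w ∈ NQ := by
        rw [memNQ, ← hw, LinearEquiv.symm_apply_apply]
        exact hd.2
      rw [hw, k3Form_ratCast, k3FormRat_isSymm.eq, hu w hwN, Rat.cast_zero]
    | zero => rw [map_zero, k3Form_zero_right]
    | add c c' _ _ hc hc' => rw [map_add, k3Form_add_right, hc, hc', add_zero]
    | smul t c _ hc => rw [map_smul, k3Form_smul_right, hc, mul_zero]
  have horth' : ∀ u ∈ k3FormRat.orthogonal NQ, ∀ d ∈ N,
      cupProduct (rfl : 2 * 1 + 2 * 1 = 2 * 2) (η.symm fun j => (u j : ℂ)) d = 0 := fun u hu d hd => by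
    rw [hηcup, LinearEquiv.apply_symm_apply, horth u hu d hd, zero_smul]
  -- (ε) real multiplication through the marking
  have hεN : ∀ u ∈ NQ, ε u = 0 := by
    intro u hu
    apply ratCastΛ_injective
    rw [← hε' u, he_N _ ((memNQ u).1 hu), map_zero, ratCastΛ_zero]
  have hεT : ∀ u ∈ k3FormRat.orthogonal NQ, ε (ε u) = (2 : ℚ) • u := by
    intro u hu
    have h2 := he_T _ (horth' u hu)
    rw [hεx, hεx, ← LinearEquiv.map_smul, ← Rat.cast_ofNat, ← ratCastΛ_smul] at h2
    exact ratCastΛ_injective (η.symm.injective h2)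
  -- (N ⊥ x₀) divisor classes are of type `(1,1)`
  have hN11Q : ∀ u ∈ NQ, k3Form (fun j => (u j : ℂ)) x₀ = 0 := by
    intro u hu
    have h := ((h3 _).1 (hN11 _ ((memNQ u).1 hu))).1
    rw [hηcup, LinearEquiv.apply_symm_apply, LinearEquiv.apply_symm_apply] at h
    exact hsmul0 h
  -- (Lefschetz) rational vectors orthogonal to `x₀` are in `N_ℚ`
  have hL11Q : ∀ u : K3Index → ℚ, k3Form (fun j => (u j : ℂ)) x₀ = 0 → u ∈ NQ := by
    intro u hu
    rw [memNQ]
    refine hL11 _ ((isRationalClass_iff_of_marking hS η hηint _).2 ⟨u, LinearEquiv.apply_symm_apply _ _⟩)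
      ((h3 _).2 ⟨?_, ?_⟩)
    · rw [hηcup, LinearEquiv.apply_symm_apply, LinearEquiv.apply_symm_apply, hu, zero_smul]
    · rw [hηcup, LinearEquiv.apply_symm_apply, LinearEquiv.apply_symm_apply,
        k3Form_ratCast_star_eq_zero hu, zero_smul]
  -- (End) `End_Hdg(T) ⊆ ℚ + ℚε`, through the marking
  have hEndQ : ∀ (φ : Module.End ℚ (K3Index → ℚ)) (Φ : Module.End ℂ (K3Index → ℂ)),
      (∀ u : K3Index → ℚ, Φ (fun i => (u i : ℂ)) = fun i => (φ u i : ℂ)) →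
      (∃ t : ℂ, Φ x₀ = t • x₀) →
      (∀ y, k3Form y x₀ = 0 → k3Form y (star x₀) = 0 →
        k3Form (Φ y) x₀ = 0 ∧ k3Form (Φ y) (star x₀) = 0) →
      (∀ u ∈ NQ, φ u = 0) → (∀ u, φ u ∈ k3FormRat.orthogonal NQ) →
      ∃ a b : ℚ, ∀ u ∈ k3FormRat.orthogonal NQ, φ u = a • u + b • ε u := by
    intro φ Φ hΦ hΦ20 hΦ11 hφN hφT
    obtain ⟨t', ht'⟩ := hΦ20
    have hΦrat := forall_intCast_of_complexification hΦ
    set F : complexBetti S (2 * 1) →ₗ[ℂ] complexBetti S (2 * 1) :=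
      η.symm.toLinearMap ∘ₗ Φ ∘ₗ η.toLinearMap with hFdef
    have hFapply : ∀ x, F x = η.symm (Φ (η x)) := fun x => rfl
    have hF_rat : ∀ x, IsRationalClass x → IsRationalClass (F x) := by
      intro x hx
      obtain ⟨w, hw⟩ := (isRationalClass_iff_of_marking hS η hηint x).1 hx
      refine (isRationalClass_iff_of_marking hS η hηint _).2 ⟨φ w, ?_⟩
      rw [hFapply, hw, hΦ, LinearEquiv.apply_symm_apply]
    have hF_type : ∀ (i j : ℕ) x, IsOfHodgeType 2 S (2 * 1) i j x →
        IsOfHodgeType 2 S (2 * 1) i j (F x) := by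
      intro i j y hy
      by_cases hij : i + j = 2 * 1
      · obtain ⟨rfl, rfl⟩ | ⟨rfl, rfl⟩ | ⟨rfl, rfl⟩ :
            (i = 2 ∧ j = 0) ∨ (i = 0 ∧ j = 2) ∨ (i = 1 ∧ j = 1) := by omega
        · obtain ⟨t, rfl⟩ := (h1 y).1 hy
          refine (h1 _).2 ⟨t * t', ?_⟩
          rw [hFapply, map_smul, LinearEquiv.apply_symm_apply, map_smul, ht', map_smul, map_smul,
            smul_smul]
        · obtain ⟨t, rfl⟩ := (h2 y).1 hy
          refine (h2 _).2 ⟨t * star t', ?_⟩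
          rw [hFapply, map_smul, LinearEquiv.apply_symm_apply, map_smul, ratEnd_star Φ hΦrat, ht',
            star_smul, map_smul, map_smul, smul_smul]
        · obtain ⟨hc1, hc2⟩ := (h3 y).1 hy
          rw [hηcup, LinearEquiv.apply_symm_apply] at hc1 hc2
          obtain ⟨hk1, hk2⟩ := hΦ11 (η y) (hsmul0 hc1) (hsmul0 hc2)
          refine (h3 _).2 ⟨?_, ?_⟩
          · rw [hFapply, hηcup, LinearEquiv.apply_symm_apply, LinearEquiv.apply_symm_apply, hk1,
              zero_smul]
          · rw [hFapply, hηcup, LinearEquiv.apply_symm_apply, LinearEquiv.apply_symm_apply, hk2,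
              zero_smul]
      · obtain rfl := isOfHodgeType_eq_zero_of_add_ne hy hij
        rw [map_zero]
        obtain ⟨A⟩ := hS.nonempty_hodgeModel
        exact IsOfHodgeType.zero A _ _ _
    have hF_N : ∀ d ∈ N, F d = 0 := by
      intro d hd
      have hd' : d ∈ Submodule.span ℂ {c : complexBetti S (2 * 1) |
          IsRationalClass c ∧ c ∈ supportedClasses S (2 * 1) 1} := by
        rw [← hspan]; exact hd
      clear hd
      induction hd' using Submodule.span_induction with
      | mem d hd =>
        obtain ⟨w, hw⟩ := (isRationalClass_iff_of_marking hS η hηint d).1 hd.1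
        have hwN : w ∈ NQ := by
          rw [memNQ, ← hw, LinearEquiv.symm_apply_apply]
          exact hd.2
        rw [hFapply, hw, hΦ, hφN w hwN, ratCastΛ_zero, map_zero]
      | zero => rw [map_zero]
      | add c c' _ _ hc hc' => rw [map_add, hc, hc', add_zero]
      | smul t c _ hc => rw [map_smul, hc, smul_zero]
    have hF_T : ∀ x : complexBetti S (2 * 1), ∀ d ∈ N,
        cupProduct (rfl : 2 * 1 + 2 * 1 = 2 * 2) (F x) d = 0 := by
      intro x d hd
      -- the functional `y ↦ (Φ y . η d)` vanishes on `Λ_ℚ`, hence everywhere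
      have hℓ : (k3FormC.flip (η d)) ∘ₗ Φ = 0 := by
        refine eq_of_forall_ratCast fun u => ?_
        rw [LinearMap.zero_apply, LinearMap.comp_apply, hΦ, LinearMap.BilinForm.flip_apply,
          k3FormC_apply]
        exact horth _ (hφT u) d hd
      have h := LinearMap.congr_fun hℓ (η x)
      rw [LinearMap.comp_apply, LinearMap.BilinForm.flip_apply, k3FormC_apply,
        LinearMap.zero_apply] at h
      rw [hFapply, hηcup, LinearEquiv.apply_symm_apply, h, zero_smul]
    obtain ⟨a, b, hab⟩ := hEnd F hF_rat hF_type hF_N hF_T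
    refine ⟨a, b, fun u hu => ?_⟩
    have h := hab _ (horth' u hu)
    rw [hFapply, LinearEquiv.apply_symm_apply, hΦ, hεx, ← LinearEquiv.map_smul, ← LinearEquiv.map_smul,
      ← map_add, ← ratCastΛ_smul, ← ratCastΛ_smul, ← ratCastΛ_add] at h
    exact ratCastΛ_injective (η.symm.injective h)
  -- `G` through the marking is a Hodge endomorphism of `Λ_ℚ`
  set Γ : Module.End ℂ (K3Index → ℂ) := η.toLinearMap ∘ₗ G ∘ₗ η.symm.toLinearMap with hΓdef
  have hΓapply : ∀ y, Γ y = η (G (η.symm y)) := fun y => rfl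
  have hσ20 : IsOfHodgeType 2 S (2 * 1) 2 0 (η.symm x₀) := (h1 _).2 ⟨1, (one_smul ℂ _).symm⟩
  have hΓ20 : ∃ t : ℂ, Γ x₀ = t • x₀ := by
    obtain ⟨t, ht⟩ := (h1 _).1 (hG_type 2 0 _ hσ20)
    exact ⟨t, by rw [hΓapply, ht, map_smul, LinearEquiv.apply_symm_apply]⟩
  have hΓ11 : ∀ y, k3Form y x₀ = 0 → k3Form y (star x₀) = 0 →
      k3Form (Γ y) x₀ = 0 ∧ k3Form (Γ y) (star x₀) = 0 := by
    intro y hy1 hy2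
    have hy : IsOfHodgeType 2 S (2 * 1) 1 1 (η.symm y) := by
      refine (h3 _).2 ⟨?_, ?_⟩
      · rw [hηcup, LinearEquiv.apply_symm_apply, LinearEquiv.apply_symm_apply, hy1, zero_smul]
      · rw [hηcup, LinearEquiv.apply_symm_apply, LinearEquiv.apply_symm_apply, hy2, zero_smul]
    obtain ⟨hc1, hc2⟩ := (h3 _).1 (hG_type 1 1 _ hy)
    rw [hηcup, LinearEquiv.apply_symm_apply] at hc1 hc2
    exact ⟨by rw [hΓapply]; exact hsmul0 hc1, by rw [hΓapply]; exact hsmul0 hc2⟩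
  obtain ⟨m, a, b, α, β, ha, hb, hgu⟩ :=
    ratEnd_normalForm NQ ε x₀ hN11Q hL11Q hεN hεT hEndQ g Γ hg' hΓ20 hΓ11
  refine ⟨m, a, b, α, β, fun i => (memNQ _).1 (ha i), fun i => (memNQ _).1 (hb i), ?_⟩
  -- transfer back to `H²(S(ℂ); ℂ)`: both sides are `ℂ`-linear and agree on `η⁻¹Λ_ℚ`
  set R : complexBetti S (2 * 1) →ₗ[ℂ] complexBetti S (2 * 1) :=
    ∑ i, ((k3FormC.flip fun j => (a i j : ℂ)) ∘ₗ η.toLinearMap).smulRight (η.symm fun j => (b i j : ℂ)) +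
      (α : ℂ) • LinearMap.id + (β : ℂ) • e with hRdef
  have hRapply : ∀ x, R x = ∑ i, k3Form (η x) (fun j => (a i j : ℂ)) • η.symm (fun j => (b i j : ℂ)) +
      (α : ℂ) • x + (β : ℂ) • e x := by
    intro x
    rw [hRdef, LinearMap.add_apply, LinearMap.add_apply, LinearMap.sum_apply, LinearMap.smul_apply,
      LinearMap.smul_apply, LinearMap.id_apply]
    congr 1; congr 1
    refine Finset.sum_congr rfl fun i _ => ?_
    rw [LinearMap.smulRight_apply, LinearMap.comp_apply, LinearEquiv.coe_coe,
      LinearMap.BilinForm.flip_apply, k3FormC_apply]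
  have hGR : G ∘ₗ η.symm.toLinearMap = R ∘ₗ η.symm.toLinearMap := by
    refine eq_of_forall_ratCast fun u => ?_
    rw [LinearMap.comp_apply, LinearMap.comp_apply, LinearEquiv.coe_coe, hRapply,
      LinearEquiv.apply_symm_apply, hεx]
    apply η.injective
    rw [hg', hgu u, ratCastΛ_add, ratCastΛ_add, ratCastΛ_sum, map_add, map_add, map_sum, map_smul,
      map_smul, LinearEquiv.apply_symm_apply, LinearEquiv.apply_symm_apply, ratCastΛ_smul, ratCastΛ_smul]
    congr 1; congr 1
    refine Finset.sum_congr rfl fun i _ => ?_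
    rw [map_smul, LinearEquiv.apply_symm_apply, ratCastΛ_smul, k3Form_ratCast]
  intro x
  have h := LinearMap.congr_fun hGR (η x)
  rw [LinearMap.comp_apply, LinearMap.comp_apply, LinearEquiv.coe_coe, LinearEquiv.symm_apply_apply] at h
  rw [h, hRapply]

end Carrier

/-! ### Algebraicity: `End_Hdg(H²(S,ℚ))` is spanned by algebraic correspondences on the sector -/

section Algebraic

variable {S : SchemeOver ℂ}

/-- **The normal form is algebraic.** If `G x = Σᵢ (ηx.aᵢ) η⁻¹bᵢ + α x + β e x` with
`η⁻¹aᵢ, η⁻¹bᵢ ∈ NS(S)`, and (D) every divisor correspondence `x ↦ (x.a) b` (`a, b ∈ NS(S)`) is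
induced by an algebraic class on `S × S` (`γ = b × a`, Fulton §16.1), (Δ) the identity of `H²` is
induced by an algebraic class (the diagonal; a hypothesis on the tree's carriers), and `e` is
induced by an algebraic class (the route's deliverable `RealMultiplicationSqrtTwoAlgebraic`), then
`G` is induced by an algebraic class (`(γ₁ + γ₂)_* = (γ₁)_* + (γ₂)_*`, `(cγ)_* = c γ_*`).
[cite: Fulton1998, §16.1] -/
theorem induced_of_normalForm (μ : OrientationFamily)
    (hS : IsSmoothProjective 2 S ∧ Subsingleton (structureSheafCohomology S.left 1) ∧
      ∃ (A : HodgeModel 2 S) (η : MForm 𝓘(ℝ, A.model) A.carrier ℂ 2),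
        IsHolomorphicInCharts η ∧ ∀ x, η x ≠ 0)
    (η : complexBetti S (2 * 1) ≃ₗ[ℂ] (K3Index → ℂ)) (p₀ : complexBetti S (2 * 2))
    (hηcup : ∀ a b : complexBetti S (2 * 1),
      cupProduct (rfl : 2 * 1 + 2 * 1 = 2 * 2) a b = k3Form (η a) (η b) • p₀)
    (hD : ∀ a ∈ algebraicClasses S 1, ∀ b ∈ algebraicClasses S 1,
      ∃ γ ∈ algebraicClasses (S ⊗ S) 2, ∀ (x : complexBetti S (2 * 1)) (t : ℂ),
        cupProduct (rfl : 2 * 1 + 2 * 1 = 2 * 2) x a = t • p₀ →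
          complexGysin μ (IsSmoothProjective.tensor_holds hS.1 hS.1) hS.1
              (SemiCartesianMonoidalCategory.fst S S)
              (rfl : 2 * 1 + 2 * 2 + 2 * 2 = 2 * 1 + 2 * (2 + 2))
              (cupProduct (rfl : 2 * 1 + 2 * 2 = 2 * 1 + 2 * 2)
                (complexBetti.map (SemiCartesianMonoidalCategory.snd S S) (2 * 1) x) γ) = t • b)
    (hΔ : ∃ γ ∈ algebraicClasses (S ⊗ S) 2, ∀ x : complexBetti S (2 * 1),
      x = complexGysin μ (IsSmoothProjective.tensor_holds hS.1 hS.1) hS.1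
            (SemiCartesianMonoidalCategory.fst S S)
            (rfl : 2 * 1 + 2 * 2 + 2 * 2 = 2 * 1 + 2 * (2 + 2))
            (cupProduct (rfl : 2 * 1 + 2 * 2 = 2 * 1 + 2 * 2)
              (complexBetti.map (SemiCartesianMonoidalCategory.snd S S) (2 * 1) x) γ))
    (e : complexBetti S (2 * 1) →ₗ[ℂ] complexBetti S (2 * 1))
    (he : ∃ γ ∈ algebraicClasses (S ⊗ S) 2, ∀ x : complexBetti S (2 * 1),
      e x = complexGysin μ (IsSmoothProjective.tensor_holds hS.1 hS.1) hS.1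
            (SemiCartesianMonoidalCategory.fst S S)
            (rfl : 2 * 1 + 2 * 2 + 2 * 2 = 2 * 1 + 2 * (2 + 2))
            (cupProduct (rfl : 2 * 1 + 2 * 2 = 2 * 1 + 2 * 2)
              (complexBetti.map (SemiCartesianMonoidalCategory.snd S S) (2 * 1) x) γ))
    {m : ℕ} (a b : Fin m → K3Index → ℚ) (α β : ℚ)
    (ha : ∀ i, η.symm (fun j => (a i j : ℂ)) ∈ algebraicClasses S 1)
    (hb : ∀ i, η.symm (fun j => (b i j : ℂ)) ∈ algebraicClasses S 1)
    (G : complexBetti S (2 * 1) →ₗ[ℂ] complexBetti S (2 * 1))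
    (hG : ∀ x, G x = ∑ i, k3Form (η x) (fun j => (a i j : ℂ)) • η.symm (fun j => (b i j : ℂ)) +
      (α : ℂ) • x + (β : ℂ) • e x) :
    ∃ γ ∈ algebraicClasses (S ⊗ S) 2, ∀ x : complexBetti S (2 * 1),
      G x = complexGysin μ (IsSmoothProjective.tensor_holds hS.1 hS.1) hS.1
            (SemiCartesianMonoidalCategory.fst S S)
            (rfl : 2 * 1 + 2 * 2 + 2 * 2 = 2 * 1 + 2 * (2 + 2))
            (cupProduct (rfl : 2 * 1 + 2 * 2 = 2 * 1 + 2 * 2)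
              (complexBetti.map (SemiCartesianMonoidalCategory.snd S S) (2 * 1) x) γ) := by
  classical
  have hT := IsSmoothProjective.tensor_holds hS.1 hS.1
  set ψ : Fin m → (complexBetti S (2 * 1) →ₗ[ℂ] complexBetti S (2 * 1)) := fun i =>
    ((k3FormC.flip fun j => (a i j : ℂ)) ∘ₗ η.toLinearMap).smulRight (η.symm fun j => (b i j : ℂ))
    with hψdef
  have hψ : ∀ i x, ψ i x = k3Form (η x) (fun j => (a i j : ℂ)) • η.symm (fun j => (b i j : ℂ)) := by
    intro i x
    rw [hψdef]
    change ((k3FormC.flip fun j => (a i j : ℂ)) ∘ₗ η.toLinearMap) x • η.symm (fun j => (b i j : ℂ)) = _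
    rw [LinearMap.comp_apply, LinearEquiv.coe_coe, LinearMap.BilinForm.flip_apply, k3FormC_apply]
  have hψind : ∀ i ∈ (Finset.univ : Finset (Fin m)), ∃ γ' ∈ algebraicClasses (S ⊗ S) 2,
      ∀ x : complexBetti S (2 * 1), ψ i x =
        complexGysin μ hT hS.1 (SemiCartesianMonoidalCategory.fst S S)
          (rfl : 2 * 1 + 2 * 2 + 2 * 2 = 2 * 1 + 2 * (2 + 2))
          (cupProduct (rfl : 2 * 1 + 2 * 2 = 2 * 1 + 2 * 2)
            (complexBetti.map (SemiCartesianMonoidalCategory.snd S S) (2 * 1) x) γ') := by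
    intro i _
    obtain ⟨γ', hγ', hγ'eq⟩ := hD _ (ha i) _ (hb i)
    refine ⟨γ', hγ', fun x => ?_⟩
    rw [hψ i x]
    exact (hγ'eq x _ (by rw [hηcup, LinearEquiv.apply_symm_apply])).symm
  have hΔ' : ∃ γ ∈ algebraicClasses (S ⊗ S) 2, ∀ x : complexBetti S (2 * 1),
      (LinearMap.id : complexBetti S (2 * 1) →ₗ[ℂ] complexBetti S (2 * 1)) x =
        complexGysin μ hT hS.1 (SemiCartesianMonoidalCategory.fst S S)
          (rfl : 2 * 1 + 2 * 2 + 2 * 2 = 2 * 1 + 2 * (2 + 2))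
          (cupProduct (rfl : 2 * 1 + 2 * 2 = 2 * 1 + 2 * 2)
            (complexBetti.map (SemiCartesianMonoidalCategory.snd S S) (2 * 1) x) γ) := hΔ
  obtain ⟨γ, hγ, hγeq⟩ := induced_add hT hS.1 (rfl : 2 * 1 + 2 * 2 = 2 * 1 + 2 * 2)
    (rfl : 2 * 1 + 2 * 2 + 2 * 2 = 2 * 1 + 2 * (2 + 2))
    (induced_add hT hS.1 rfl rfl (induced_sum hT hS.1 rfl rfl Finset.univ ψ hψind)
      (induced_smul hT hS.1 rfl rfl (α : ℂ) hΔ'))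
    (induced_smul hT hS.1 rfl rfl (β : ℂ) he)
  refine ⟨γ, hγ, fun x => ?_⟩
  rw [← hγeq x, LinearMap.add_apply, LinearMap.add_apply, LinearMap.sum_apply, LinearMap.smul_apply,
    LinearMap.smul_apply, LinearMap.id_apply, hG x]
  congr 1; congr 1
  exact Finset.sum_congr rfl fun i _ => (hψ i x).symm

end Algebraic

end Summit.HodgeConjecture.HodgeConjecture.Theorems.NikulinTwinTransport

end
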